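import Summits.Langlands.Langlands.Theses.GenuineTorsionSplit

/-!
# Route GenuineTorsionSplit — Assembly

The assembly item (stmt-Langlands-27090) of the child route `GenuineTorsionSplit` (decomp-langlands lens-4 gen 19; a gate-native D-0170
refining child: `--refines route-Langlands-FiniteLevelTorsionSplit:DefectZeroTorsionAutomorphy`, edge split, depth 1, no FRAME item) for the
crux TZ = `FiniteLevelTorsionSplit.DefectZeroTorsionAutomorphy` (stmt-Langlands-26851):
`LiftableTorsionAutomorphy → GenuineTorsionAutomorphy → FiniteLevelTorsionSplit.DefectZeroTorsionAutomorphy`.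

This is literally the type of the route file's sorry-free deciding theorem `Summit.Langlands.Langlands.Theses.GenuineTorsionSplit.closes`
(one excluded middle on the characteristic-zero avatar CZ).  Nothing here proves `Langlands` (nor TZ): the assembly records only that the two
ledger items of the route, taken together, imply the refined crux.
-/

set_option linter.dupNamespace false -- project-wide option (lakefile weak.linter.dupNamespace); `Summit.Langlands.Langlands` is the mandated namespace

namespace Summit.Langlands.Langlands.Theorems

/-- **Assembly of route GenuineTorsionSplit** (stmt-Langlands-27090): `LZ → GZ → FiniteLevelTorsionSplit.DefectZeroTorsionAutomorphy`.
Proof: unfold `Assembly` and apply the route's deciding theorem `Theses.GenuineTorsionSplit.closes`. -/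
theorem genuineTorsionSplit_assembly_proof :
    Summit.Langlands.Langlands.Theses.GenuineTorsionSplit.Assembly := by
  unfold Summit.Langlands.Langlands.Theses.GenuineTorsionSplit.Assembly
  exact Summit.Langlands.Langlands.Theses.GenuineTorsionSplit.closes

end Summit.Langlands.Langlands.Theorems
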